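import Summits.CriticalPhenomena.PercolationContinuityZ3.Theorems.SahiAECornerEnvelopePrelim
import Mathlib.MeasureTheory.Integral.Marginal

/-!
# The separable tilt — part 1/4: preliminaries (dummy coordinate, lattice surgery, essential infima, potentials)

Support file of the Sahi cell (`prim-sahi`): literature seat gen35's kernel file `SahiAESeparableTilt.lean`
(evidence n°8688 on `stmt-CriticalPhenomena-4575`, sha256 `af5f8450…be96`, 1048 lines), landed by a prover seat in FOUR
parts because tree `Theorems/` files are capped at 400 lines: `SahiAESeparableTiltPrelim`, `SahiAESeparableTiltLowerSet`,
`SahiAESeparableTiltCoord`, `SahiAESeparableTilt` (main theorems).  Every declaration is byte-identical to the evidence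
file and keeps its namespace `…Theorems.SahiAESeparableTilt`; only imports, module docstrings and the grouping of the
sections into files differ.  Theorems only (no definitions, no named facts, no sorries).

This part (sections `Dummy`, `Lattice`, `EssInf`, `MeasEssInf`, `Potential` of the evidence file):
* `lintegral_lintegral_update` — the dummy-coordinate identity `∫_x ∫_r g(update x i r) = ⊤ · ∫ g` on `ℝ^ι`;
  `quasiMeasurePreserving_update`, `quasiMeasurePreserving_eval`, `volume_pi_ne_zero` — quasi-invariance of Lebesgue
  measure under coordinate surgery / projection.
* `update_inf_update_of_le`, `update_sup_update_of_le` — coordinate surgery and the lattice operations.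
* `essInf_le_of_measure_ne_zero`, `measure_ne_zero_of_essInf_lt`, `ae_essInf_le_of_forall_le`, `abs_essInf_le` —
  essential infima of bounded real functions; `measurable_essInf_of_bounded` — measurability of a parametrised
  essential infimum (`μ` s-finite, `μ ≠ 0`).
* `exists_potential_of_cocycle` — a bounded measurable cocycle on `ℝ`, super-additive everywhere and sub-additive on
  good chains (a.e. pair good), has a potential from a generic base point: `a(t) − a(r) ≤ A(r,t)` for a.e. good `r ≤ t`.

Used by parts 2–4 (`SahiAESeparableTiltLowerSet`, `SahiAESeparableTiltCoord`, `SahiAESeparableTilt`).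
No sorries, no new axioms (`#print axioms`: propext, Classical.choice, Quot.sound).
-/

noncomputable section

namespace Summit.CriticalPhenomena.PercolationContinuityZ3.Theorems.SahiAESeparableTilt

open MeasureTheory Set Filter Topology Metric Function
open Summit.CriticalPhenomena.PercolationContinuityZ3.Theorems.SahiAEFourFunctions
open scoped ENNReal NNReal

variable {ι : Type*} [Fintype ι]

/-! ### Lebesgue measure on `ℝ^ι`: the dummy-coordinate identity and quasi-invariance under coordinate surgery -/

section Dummy

variable [DecidableEq ι]

/-- **Dummy-coordinate identity.**  Integrating `g (update x i r)` over `r ∈ ℝ` and `x ∈ ℝ^ι` (whose `i`-th coordinate is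
then a dummy variable of infinite Lebesgue mass) gives `⊤ · ∫ g`. [folklore] -/
theorem lintegral_lintegral_update (i : ι) {g : (ι → ℝ) → ℝ≥0∞} (hg : Measurable g) :
    ∫⁻ x, ∫⁻ r, g (update x i r) ∂(volume : Measure ℝ) ∂(volume : Measure (ι → ℝ)) =
      ⊤ * ∫⁻ x, g x ∂(volume : Measure (ι → ℝ)) := by
  have h1 : Measurable fun x : ι → ℝ => ∫⁻ r, g (update x i r) ∂(volume : Measure ℝ) := by
    have := hg.lmarginal (fun _ : ι => (volume : Measure ℝ)) (s := {i})
    simpa only [lmarginal_singleton] using this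
  have h2 : Measurable fun x : ι → ℝ => ⊤ * g x := measurable_const.mul hg
  rw [volume_pi, ← lintegral_const_mul ⊤ hg]
  refine lintegral_eq_of_lmarginal_eq {i} h1 h2 ?_
  rw [lmarginal_singleton, lmarginal_singleton]
  funext x
  simp only [update_idem]
  rw [lintegral_const, lintegral_const_mul (f := fun r => g (update x i r)) ⊤ (hg.comp (measurable_update x)),
    Real.volume_univ, mul_comm]

/-- **Quasi-invariance of Lebesgue measure under coordinate surgery**: `(x, r) ↦ update x i r` pulls `λ_{ℝ^ι}`-null
sets back to `λ_{ℝ^ι} ⊗ λ_ℝ`-null sets. [folklore] -/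
theorem quasiMeasurePreserving_update (i : ι) :
    Measure.QuasiMeasurePreserving (fun p : (ι → ℝ) × ℝ => update p.1 i p.2)
      ((volume : Measure (ι → ℝ)).prod (volume : Measure ℝ)) (volume : Measure (ι → ℝ)) := by
  refine ⟨measurable_update', Measure.AbsolutelyContinuous.mk fun N hN hN0 => ?_⟩
  rw [Measure.map_apply measurable_update' hN, Measure.prod_apply (measurable_update' hN)]
  have e : ∀ x : ι → ℝ, (volume : Measure ℝ) (Prod.mk x ⁻¹' ((fun p : (ι → ℝ) × ℝ => update p.1 i p.2) ⁻¹' N)) =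
      ∫⁻ r, N.indicator 1 (update x i r) ∂(volume : Measure ℝ) := by
    intro x
    have ex : Prod.mk x ⁻¹' ((fun p : (ι → ℝ) × ℝ => update p.1 i p.2) ⁻¹' N) = (update x i) ⁻¹' N := rfl
    rw [ex, ← lintegral_indicator_one ((measurable_update x) hN)]
    rfl
  simp_rw [e]
  rw [lintegral_lintegral_update i (measurable_one.indicator hN), lintegral_indicator_one hN, hN0, mul_zero]

omit [DecidableEq ι] in
/-- A coordinate projection pulls Lebesgue-null sets of `ℝ` back to null sets of `ℝ^ι`. [folklore] -/
theorem quasiMeasurePreserving_eval (i : ι) :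
    Measure.QuasiMeasurePreserving (fun x : ι → ℝ => x i) (volume : Measure (ι → ℝ)) (volume : Measure ℝ) := by
  classical
  refine ⟨measurable_pi_apply i, Measure.AbsolutelyContinuous.mk fun N hN hN0 => ?_⟩
  rw [Measure.map_apply (measurable_pi_apply i) hN]
  have e : (fun x : ι → ℝ => x i) ⁻¹' N = Set.pi univ (update (fun _ : ι => (univ : Set ℝ)) i N) := by
    ext x
    simp only [mem_preimage, mem_univ_pi]
    refine ⟨fun h j => ?_, fun h => by simpa using h i⟩
    by_cases hj : j = i
    · subst hj; simpa using h
    · simp [hj]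
  rw [e, volume_pi_pi]
  exact Finset.prod_eq_zero (Finset.mem_univ i) (by simpa using hN0)

omit [DecidableEq ι] in
/-- Lebesgue measure on `ℝ^ι` is not the zero measure. [folklore] -/
theorem volume_pi_ne_zero : (volume : Measure (ι → ℝ)) ≠ 0 := by
  intro h0
  have h1 : volume (closedBall (0 : ι → ℝ) 1) = 0 := by rw [h0]; rfl
  rw [volume_closedBall_eq_pow_mul (0 : ι → ℝ) zero_le_one, ENNReal.ofReal_one, one_pow, mul_one] at h1
  exact pow_ne_zero _ two_ne_zero h1

end Dummy

/-! ### Coordinate surgery and the lattice operations -/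

section Lattice

variable [DecidableEq ι]

omit [Fintype ι] in
/-- For `x ≤ y` and `r ≤ s`: `update x i s ⊓ update y i r = update x i r`. [folklore] -/
theorem update_inf_update_of_le {x y : ι → ℝ} (hxy : x ≤ y) {r s : ℝ} (hrs : r ≤ s) (i : ι) :
    update x i s ⊓ update y i r = update x i r := by
  funext j
  by_cases hj : j = i
  · subst hj; simp [hrs]
  · simp [hj, hxy j]

omit [Fintype ι] in
/-- For `x ≤ y` and `r ≤ s`: `update x i s ⊔ update y i r = update y i s`. [folklore] -/
theorem update_sup_update_of_le {x y : ι → ℝ} (hxy : x ≤ y) {r s : ℝ} (hrs : r ≤ s) (i : ι) :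
    update x i s ⊔ update y i r = update y i s := by
  funext j
  by_cases hj : j = i
  · subst hj; simp [hrs]
  · simp [hj, hxy j]

end Lattice

/-! ### Essential infima of bounded real functions -/

section EssInf

variable {α : Type*} [MeasurableSpace α] {μ : Measure α}

/-- If the level set `{f < c}` has positive measure then `ess inf f ≤ c` (`f` bounded below). [folklore] -/
theorem essInf_le_of_measure_ne_zero {f : α → ℝ} {lo c : ℝ} (hlo : ∀ x, lo ≤ f x) (h : μ {x | f x < c} ≠ 0) :
    essInf f μ ≤ c := by
  rw [essInf_eq_sSup]
  refine csSup_le ⟨lo, ?_⟩ fun a ha => ?_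
  · show μ {x | f x < lo} = 0
    have e : {x | f x < lo} = ∅ := by
      ext x
      simp only [mem_setOf_eq, mem_empty_iff_false, iff_false, not_lt]
      exact hlo x
    rw [e, measure_empty]
  · by_contra hac
    push Not at hac
    exact h (measure_mono_null (fun x (hx : f x < c) => hx.trans hac) ha)

/-- If `ess inf f < c` then `{f < c}` has positive measure (`μ ≠ 0`, `f` bounded above). [folklore] -/
theorem measure_ne_zero_of_essInf_lt {f : α → ℝ} {hi c : ℝ} (hhi : ∀ x, f x ≤ hi) (hμ : μ ≠ 0)
    (h : essInf f μ < c) : μ {x | f x < c} ≠ 0 := by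
  intro h0
  rw [essInf_eq_sSup] at h
  have hbdd : BddAbove {a : ℝ | μ {x | f x < a} = 0} := by
    refine ⟨hi + 1, fun a ha => ?_⟩
    by_contra hlt
    push Not at hlt
    have e : {x | f x < a} = univ := by
      ext x
      simp only [mem_setOf_eq, mem_univ, iff_true]
      linarith [hhi x]
    have ha' : μ {x | f x < a} = 0 := ha
    rw [e] at ha'
    exact hμ (Measure.measure_univ_eq_zero.1 ha')
  exact (lt_irrefl c) (lt_of_le_of_lt (le_csSup hbdd h0) h)

/-- `ess inf f ≤ f` almost everywhere (`f` bounded below). [folklore] -/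
theorem ae_essInf_le_of_forall_le {f : α → ℝ} {lo : ℝ} (hlo : ∀ x, lo ≤ f x) : ∀ᵐ x ∂μ, essInf f μ ≤ f x :=
  ae_essInf_le ⟨lo, eventually_map.2 (Eventually.of_forall fun x => hlo x)⟩

/-- Bounds pass to the essential infimum (`μ ≠ 0`). [folklore] -/
theorem abs_essInf_le {f : α → ℝ} {B : ℝ} (hB : ∀ x, |f x| ≤ B) (hμ : μ ≠ 0) : |essInf f μ| ≤ B := by
  have hlo : ∀ x, -B ≤ f x := fun x => (abs_le.1 (hB x)).1
  have hhi : ∀ x, f x ≤ B := fun x => (abs_le.1 (hB x)).2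
  rw [abs_le]
  constructor
  · rw [essInf_eq_sSup]
    have hbdd : BddAbove {a : ℝ | μ {x | f x < a} = 0} := by
      refine ⟨B + 1, fun a ha => ?_⟩
      by_contra hlt
      push Not at hlt
      have e : {x | f x < a} = univ := by
        ext x
        simp only [mem_setOf_eq, mem_univ, iff_true]
        linarith [hhi x]
      have ha' : μ {x | f x < a} = 0 := ha
      rw [e] at ha'
      exact hμ (Measure.measure_univ_eq_zero.1 ha')
    refine le_csSup hbdd ?_
    show μ {x | f x < -B} = 0
    have e : {x | f x < -B} = ∅ := by
      ext x
      simp only [mem_setOf_eq, mem_empty_iff_false, iff_false, not_lt]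
      exact hlo x
    rw [e, measure_empty]
  · rw [essInf_eq_sSup]
    refine csSup_le ⟨-B, ?_⟩ fun a ha => ?_
    · show μ {x | f x < -B} = 0
      have e : {x | f x < -B} = ∅ := by
        ext x
        simp only [mem_setOf_eq, mem_empty_iff_false, iff_false, not_lt]
        exact hlo x
      rw [e, measure_empty]
    · by_contra hlt
      push Not at hlt
      have e : {x | f x < a} = univ := by
        ext x
        simp only [mem_setOf_eq, mem_univ, iff_true]
        linarith [hhi x]
      have ha' : μ {x | f x < a} = 0 := ha
      rw [e] at ha'
      exact hμ (Measure.measure_univ_eq_zero.1 ha')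

end EssInf

/-! ### Measurability of a parametrised essential infimum -/

section MeasEssInf

variable {α β : Type*} [MeasurableSpace α] [MeasurableSpace β] {μ : Measure α} [SFinite μ]

/-- **Measurability of `b ↦ ess inf_a F(b,a)`** for a jointly measurable bounded `F` (`μ` s-finite, `μ ≠ 0`): the
sub-level sets are countable unions of `{b : μ{a : F(b,a) < q} ≠ 0}`, `q ∈ ℚ`. [folklore] -/
theorem measurable_essInf_of_bounded (hμ : μ ≠ 0) {F : β → α → ℝ} (hF : Measurable fun p : β × α => F p.1 p.2)
    {lo hi : ℝ} (hlo : ∀ b a, lo ≤ F b a) (hhi : ∀ b a, F b a ≤ hi) :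
    Measurable fun b => essInf (F b) μ := by
  refine measurable_of_Iio fun c => ?_
  have hS : ∀ q : ℚ, MeasurableSet {b : β | μ {a | F b a < q} ≠ 0} := by
    intro q
    have hT : MeasurableSet {p : β × α | F p.1 p.2 < q} := measurableSet_lt hF measurable_const
    have hm : Measurable fun b : β => μ (Prod.mk b ⁻¹' {p : β × α | F p.1 p.2 < q}) :=
      measurable_measure_prodMk_left hT
    have e : {b : β | μ {a | F b a < q} ≠ 0} =
        (fun b : β => μ (Prod.mk b ⁻¹' {p : β × α | F p.1 p.2 < q})) ⁻¹' ({0}ᶜ) := rfl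
    rw [e]
    exact hm (measurableSet_singleton 0).compl
  have e : (fun b => essInf (F b) μ) ⁻¹' Iio c =
      ⋃ q : ℚ, ⋃ (_ : (q : ℝ) < c), {b | μ {a | F b a < q} ≠ 0} := by
    ext b
    simp only [mem_preimage, mem_Iio, mem_iUnion, mem_setOf_eq]
    constructor
    · intro h
      obtain ⟨q, h1, h2⟩ := exists_rat_btwn h
      exact ⟨q, h2, measure_ne_zero_of_essInf_lt (f := F b) (hhi b) hμ h1⟩
    · rintro ⟨q, hq, hne⟩
      exact (essInf_le_of_measure_ne_zero (f := F b) (hlo b) hne).trans_lt hq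
  rw [e]
  exact MeasurableSet.iUnion fun q => MeasurableSet.iUnion fun _ => hS q

end MeasEssInf

/-! ### Potentials for additive cocycles on good chains -/

section Potential

/-- **An a.e. additive cocycle has a potential.**  Let `A : ℝ × ℝ → ℝ` be bounded, measurable, SUPER-additive on all
triples and SUB-additive on triples `r ≤ s ≤ t` whose two links are "good", where almost every pair `r ≤ s` is good.
Then for a generic base point `c`, `a(t) := A(c,t)` (`t ≥ c`), `a(t) := −A(t,c)` (`t < c`) satisfies
`a(t) − a(r) ≤ A(r,t)` for almost every good pair `r ≤ t`. [this work] -/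
theorem exists_potential_of_cocycle {A : ℝ → ℝ → ℝ} (hA : Measurable fun p : ℝ × ℝ => A p.1 p.2) {B : ℝ}
    (hB : ∀ r s, |A r s| ≤ B) (P : ℝ → ℝ → Prop)
    (hP : ∀ᵐ p ∂(volume : Measure ℝ).prod (volume : Measure ℝ), p.1 ≤ p.2 → P p.1 p.2)
    (hsuper : ∀ r s t, A r s + A s t ≤ A r t)
    (hsub : ∀ r s t, r ≤ s → s ≤ t → P r s → P s t → A r t ≤ A r s + A s t) :
    ∃ a : ℝ → ℝ, Measurable a ∧ (∀ t, |a t| ≤ B) ∧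
      ∀ᵐ p ∂(volume : Measure ℝ).prod (volume : Measure ℝ), p.1 ≤ p.2 → P p.1 p.2 → a p.2 - a p.1 ≤ A p.1 p.2 := by
  have h1 : ∀ᵐ r ∂(volume : Measure ℝ), ∀ᵐ s ∂(volume : Measure ℝ), r ≤ s → P r s :=
    Measure.ae_ae_of_ae_prod (p := fun p : ℝ × ℝ => p.1 ≤ p.2 → P p.1 p.2) hP
  have h2 : ∀ᵐ s ∂(volume : Measure ℝ), ∀ᵐ r ∂(volume : Measure ℝ), r ≤ s → P r s := by
    have hsw := (Measure.measurePreserving_swap (μ := (volume : Measure ℝ))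
      (ν := (volume : Measure ℝ))).quasiMeasurePreserving.ae hP
    exact Measure.ae_ae_of_ae_prod (p := fun p : ℝ × ℝ => p.2 ≤ p.1 → P p.2 p.1)
      (by simpa only [Prod.fst_swap, Prod.snd_swap] using hsw)
  have hvol : (volume : Measure ℝ) ≠ 0 := by
    intro h
    have h' := Real.volume_univ
    rw [h, Measure.coe_zero, Pi.zero_apply] at h'
    exact ENNReal.zero_ne_top h'
  haveI : (ae (volume : Measure ℝ)).NeBot := ae_neBot.2 hvol
  obtain ⟨c, hc1, hc2⟩ := (h1.and h2).exists
  -- the potential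
  refine ⟨fun t => if c ≤ t then A c t else -A t c, ?_, ?_, ?_⟩
  · exact Measurable.ite measurableSet_Ici (hA.comp (measurable_const.prodMk measurable_id))
      ((hA.comp (measurable_id.prodMk measurable_const)).neg)
  · intro t
    show |(if c ≤ t then A c t else -A t c)| ≤ B
    by_cases ht : c ≤ t
    · rw [if_pos ht]; exact hB c t
    · rw [if_neg ht, abs_neg]; exact hB t c
  · have G1 : ∀ᵐ p ∂(volume : Measure ℝ).prod (volume : Measure ℝ), c ≤ p.1 → P c p.1 :=
      (Measure.quasiMeasurePreserving_fst (μ := (volume : Measure ℝ)) (ν := (volume : Measure ℝ))).ae hc1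
    have G2 : ∀ᵐ p ∂(volume : Measure ℝ).prod (volume : Measure ℝ), p.2 ≤ c → P p.2 c :=
      (Measure.quasiMeasurePreserving_snd (μ := (volume : Measure ℝ)) (ν := (volume : Measure ℝ))).ae hc2
    filter_upwards [G1, G2] with p g1 g2 hle hP'
    by_cases h1c : c ≤ p.1
    · have h2c : c ≤ p.2 := h1c.trans hle
      simp only [if_pos h1c, if_pos h2c]
      have := hsub c p.1 p.2 h1c hle (g1 h1c) hP'
      linarith
    · rw [not_le] at h1c
      by_cases h2c : c ≤ p.2
      · simp only [if_neg (not_le.2 h1c), if_pos h2c]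
        have := hsuper p.1 c p.2
        linarith
      · rw [not_le] at h2c
        simp only [if_neg (not_le.2 h1c), if_neg (not_le.2 h2c)]
        have := hsub p.1 p.2 c hle h2c.le hP' (g2 h2c.le)
        linarith

end Potential

end Summit.CriticalPhenomena.PercolationContinuityZ3.Theorems.SahiAESeparableTilt

end
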